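import Summits.BirchSwinnertonDyer.Rank1Residual.ManinAdditive.TwistOrbitManinNearInvarianceAtTwo
import Summits.BirchSwinnertonDyer.Rank1Residual.ManinAdditive.TwoTwistCommutingOrbitDiscrDirection
import HarnessLib
import HarnessLib.Audit.Tags

/-!
# §29c (g6) E-an-36 ⟺ E-an-35 at `2` (PROVED EDGE): 2-adic Manin invariance on commuting optimal `χ±8`-pairs
# IS the discriminant direction law at `2` (cell `bsd-f2-manin`, seat `-an`).

From `twoTwist_optimal_commuting_manin_near_invariance` (§29b) exactly as the odd-prime edge
`commutingOrbitManinValEq_iff_discrDirection` (§27) follows from `pStar_optimal_commuting_manin_near_invariance`;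
the reverse pair `(W′, W)` is supplied by `exists_smul_quadraticTwist_eq_of_smul_quadraticTwist_eq`.
Nothing conjectural is asserted. [cite: Watkins2002, §2.1]
-/

noncomputable section

open scoped MatrixGroups ModularForm

open CongruenceSubgroup WeierstrassCurve
  Literature.NumberTheory.DiophantineGeometry
  Literature.NumberTheory.EllipticCurves
  Literature.NumberTheory.EllipticCurves.ModularForms

namespace Summit.BirchSwinnertonDyer.Rank1Residual.ManinAdditive

section NearInvarianceAtTwoEdges

/-- **E-an-36 ⟺ E-an-35 (PROVED): 2-adic Manin invariance on commuting `χ±8`-pairs IS the direction law at `2`.** -/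
theorem twoTwistCommutingOrbitManinValEq_iff_discrDirection (d : ℤ) :
    TwoTwistCommutingOrbitManinValEq d ↔ TwoTwistCommutingOrbitDiscrDirection d := by
  constructor
  · intro hV hd W W' _ _ _ _ _ _ u D D' hD hD' hM hN hu hdeg
    have hc := hV hd W W' u D D' hD hD' hM hN hu
    rcases twoTwist_optimal_commuting_manin_near_invariance hd W W' u D D' hD hD' hM hN hu with
      ⟨-, h⟩ | ⟨hdeg', -⟩
    · omega
    · exfalso
      have hpos : 0 < D.modularDegree := D.deg_pos
      omega
  · intro hΔ hd W W' _ _ _ _ _ _ u D D' hD hD' hM hN hu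
    rcases twoTwist_optimal_commuting_manin_near_invariance hd W W' u D D' hD hD' hM hN hu with
      ⟨hdeg, h⟩ | ⟨hdeg, h⟩
    · have := hΔ hd W W' u D D' hD hD' hM hN hu hdeg
      omega
    · -- symmetric: apply the direction law to the reversed pair (W′, W)
      have hdZ : d ≠ 0 := by rcases hd with rfl | rfl <;> norm_num
      have hd0 : ((d : ℤ) : ℚ) ≠ 0 := by exact_mod_cast hdZ
      obtain ⟨C, hC⟩ := exists_smul_quadraticTwist_eq_of_smul_quadraticTwist_eq hd0 u hu
      have hM' : 2 ^ 6 ∣ W'.conductorNorm ℤ := by rw [hN]; exact hM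
      have := hΔ hd W' W C D' D hD' hD hM' hN.symm hC (by rw [hdeg])
      omega

end NearInvarianceAtTwoEdges

end Summit.BirchSwinnertonDyer.Rank1Residual.ManinAdditive

end
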